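import Summits.CriticalPhenomena.PercolationContinuityZ3.Theorems.PercNearOneGluingNoHeavyQuantScaleDefect
import Summits.CriticalPhenomena.PercolationContinuityZ3.Theorems.PercNearOneGluingNoHeavyQuantTowerCount
import HarnessLib

/-!
# QUANT lane / PAPER-2 rate track (ARM-1, gen 10): NO RUNG BETWEEN log* AND SUB-EXPONENTIAL WINDOWS —
# a renormalisation window of tower height `h ≥ 1` caps the scale-defect method at `(1 − η)^{⌊log*₂ N / h⌋}`

builds on p205010 (kernel theorem, internal audit signed; external expert review pending)

Cell `prim-quant`, seat `prim-quant-arm-1` (rate-theorem architect), memo `run/shared/lean/prim/quant/RATE-PLAN.md` §2.3 / §19.  Proof-only.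

The lane's unconditional rate is `π_{p_c}(N) ≤ (1 − η)^{I_L(N)}` (`Quant.oneArmRate_of_scaleDefect`), `I_L = iterCount L` the number of
complete `L`-annuli below `N`.  RATE-PLAN §2.3 records the dictionary `L(m) ≤ m^α ⟹ polylog`, `L = exp∘exp∘poly ⟹ (1−η)^{½ log* N}` and the
sentence "no intermediate class": this file is its kernel form, for EVERY window map and every base-2 tower height `h`:

* `Quant.tower_le_scaleSeq_of_iterExp_le`: if `2↑↑h(m) ≤ L(m)` for all `m` (`iterExp 2 h m ≤ L m`: the window dominates a height-`h` tower
  of 2's over `m`), then `tower 2 (h·j) ≤ scaleSeq L j` for every `j`;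
* **`Quant.mul_iterCount_le_logStar`**: under the same hypothesis **`h · I_L(N) ≤ log*₂ N`** for every `N`; in particular (`h = 1`,
  `Quant.iterCount_le_logStar_of_two_pow_le`) ANY window with `L(m) ≥ 2^m` has `I_L(N) ≤ log*₂ N`, and
  **`Quant.pow_logStar_le_pow_iterCount`**: the certified bound `(1 − η)^{I_L(N)}` is then NEVER below `(1 − η)^{log*₂ N}` (`0 ≤ η ≤ 1`).

READING (architecture, RATE-PLAN §19.4).  Every rate class strictly better than log* — `(log^{(k)} N)^{−c}` for any fixed `k`, polylog,
power — needs a window map that is eventually BELOW `2^m`, i.e. sub-exponential in the seed scale; inside the Kozma–Nitzan criterion the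
window is `exp∘exp∘poly` (seed trials × contact levels, `Quant.knLHi_ge_tower`) and removing ONE of the two exponentials (e.g. a seedless
Step III alone, RATE-PLAN §5) still leaves `L(m) ≥ 2^m`, hence by this file at most `(1−η)^{log*₂ N}`: the class is unchanged, exactly as
the lane's verdict V145/P2 §7.0 said in prose.  The KN instance `2·I(N) ≤ log*₂ N + 2` is the tree's `Quant.two_mul_iterCount_knLHi_le`
(`h = 2` with the offsets of `knLHi`); here the statement is window-agnostic.  Nothing about the RATE changes.
[cite: Grimmett1999, §7.2 (iterated box scales)] [folklore]
-/

namespace Summit.CriticalPhenomena.PercolationContinuityZ3.Theorems.Quant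

variable {L : ℕ → ℕ}

/-- A window dominating a height-`h` tower of 2's lies above the identity: `iterExp 2 h m ≤ L m` ⟹ `m ≤ L m`. [folklore] -/
theorem le_self_of_iterExp_le {h : ℕ} (hL : ∀ m, iterExp 2 h m ≤ L m) (m : ℕ) : m ≤ L m :=
  le_trans (le_trans (Nat.le_add_right m h) (add_le_iterExp le_rfl h m)) (hL m)

/-- **Towers below the scale sequence**: if the window dominates a height-`h` tower over the seed, `iterExp 2 h m ≤ L m` for all `m`,
then `tower 2 (h·j) ≤ scaleSeq L j` for every `j` (induction: `tower 2 (h(j+1)) = iterExp 2 h (tower 2 (hj)) ≤ iterExp 2 h (s_j) ≤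
iterExp 2 h (s_j + 1) ≤ L(s_j + 1) = s_{j+1}`). [folklore] -/
theorem tower_le_scaleSeq_of_iterExp_le {h : ℕ} (hL : ∀ m, iterExp 2 h m ≤ L m) (j : ℕ) :
    tower 2 (h * j) ≤ scaleSeq L j := by
  induction j with
  | zero => simp
  | succ j ih =>
    rw [Nat.mul_succ, Nat.add_comm, tower_add, scaleSeq_succ]
    calc iterExp 2 h (tower 2 (h * j)) ≤ iterExp 2 h (scaleSeq L j) := iterExp_mono (by norm_num) h ih
      _ ≤ iterExp 2 h (scaleSeq L j + 1) := iterExp_mono (by norm_num) h (Nat.le_succ _)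
      _ ≤ L (scaleSeq L j + 1) := hL _

/-- **NO INTERMEDIATE RUNG (window-agnostic): `h · I_L(N) ≤ log*₂ N`** whenever the window dominates a height-`h` tower of 2's over the seed
(`iterExp 2 h m ≤ L m` for all `m`).  For the Kozma–Nitzan window (`h = 2`) this is the tree's `two_mul_iterCount_knLHi_le` up to offsets;
for `h = 1` it says that ANY at-least-exponential window certifies at most `log*₂ N` defect annuli below `N`. [folklore] -/
theorem mul_iterCount_le_logStar {h : ℕ} (hL : ∀ m, iterExp 2 h m ≤ L m) (N : ℕ) : h * iterCount L N ≤ logStar 2 N := by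
  rcases Nat.eq_zero_or_pos N with hN | hN
  · subst hN
    have : iterCount L 0 = 0 := le_antisymm (iterCount_le L 0) (Nat.zero_le _)
    rw [this, Nat.mul_zero]
    exact Nat.zero_le _
  · rw [le_logStar_iff (by norm_num) hN]
    exact (tower_le_scaleSeq_of_iterExp_le hL _).trans (scaleSeq_iterCount_le hN)

/-- **`h = 1`: an at-least-exponential window gives at most `log*₂ N` annuli** — `2^m ≤ L m` for all `m` ⟹ `I_L(N) ≤ log*₂ N`. [folklore] -/
theorem iterCount_le_logStar_of_two_pow_le (hL : ∀ m, 2 ^ m ≤ L m) (N : ℕ) : iterCount L N ≤ logStar 2 N := by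
  have h1 : ∀ m, iterExp 2 1 m ≤ L m := fun m => by simpa [iterExp_succ] using hL m
  simpa using mul_iterCount_le_logStar h1 N

/-- **The certified bound of the scale-defect method is never below `(1 − η)^{log*₂ N}` for at-least-exponential windows**:
`2^m ≤ L m` (all `m`), `0 ≤ η ≤ 1` ⟹ `(1 − η)^{log*₂ N} ≤ (1 − η)^{I_L(N)}` — the right side is what `Quant.oneArmRate_of_scaleDefect`
proves about `π_p(N)` from `ScaleDefectAt d p L η`.  So a class better than log* needs windows eventually below `2^m`. [folklore] -/
theorem pow_logStar_le_pow_iterCount (hL : ∀ m, 2 ^ m ≤ L m) {η : ℝ} (hη0 : 0 ≤ η) (hη1 : η ≤ 1) (N : ℕ) :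
    (1 - η) ^ logStar 2 N ≤ (1 - η) ^ iterCount L N :=
  pow_le_pow_of_le_one (by linarith) (by linarith) (iterCount_le_logStar_of_two_pow_le hL N)

/-- **The same with a tower of height `h`**: `iterExp 2 h m ≤ L m` (all `m`, `h ≥ 1`), `0 ≤ η ≤ 1` ⟹
`(1 − η)^{⌊log*₂ N / h⌋} ≤ (1 − η)^{I_L(N)}`. [folklore] -/
theorem pow_logStar_div_le_pow_iterCount {h : ℕ} (hh : 1 ≤ h) (hL : ∀ m, iterExp 2 h m ≤ L m) {η : ℝ} (hη0 : 0 ≤ η)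
    (hη1 : η ≤ 1) (N : ℕ) : (1 - η) ^ (logStar 2 N / h) ≤ (1 - η) ^ iterCount L N := by
  refine pow_le_pow_of_le_one (by linarith) (by linarith) ?_
  have := mul_iterCount_le_logStar hL N
  exact (Nat.le_div_iff_mul_le hh).2 (by rwa [Nat.mul_comm] at this)

end Summit.CriticalPhenomena.PercolationContinuityZ3.Theorems.Quant
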